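import Summits.ResolutionOfSingularities.ResolutionOfSingularities.Theorems.FrobeniusClosingSteerBadCurveStep
import Mathlib.RingTheory.Ideal.Height
import Mathlib.RingTheory.Ideal.MinimalPrime.Noetherian
import HarnessLib

/-!
# Bad-curve lineages of the LOW tower: contraction is injective, finiteness, stabilisation (D3c, W4.1)

W4.1, crux `Steer` (stmt-ResolutionOfSingularities-16345), σ-line at `p = 2`, LOW half, piece **D3c = F5 TAMING**
(res-L0-w41-plan-1 RULING 18d / 21b(iv); §σ2.23/§σ2.24 of res-L0-w41-strat-2; tower = res-D-pv-012's D3a).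
Generic, Theses-free, def-free bookkeeping for the LINEAGES of height-one primes along a chain of quadratic transforms of
subrings of one field (sequel of `FrobeniusClosingSteerBadCurveStep.lean`):

* `exists_div_of_quadraticTransform` — off the exceptional prime every element of `A'` is a fraction `a/b` of elements of
  `A` with `b ∉ 𝔮'` (so `A' ⊆ A_{𝔮' ∩ A}` inside the field);
* `mem_iff_of_quadraticTransform`, `eq_of_comap_eq_of_quadraticTransform` — a non-exceptional prime `𝔮'` of `A'` is
  DETERMINED by its contraction `𝔮' ∩ A`: the contraction map on non-exceptional primes is injective (a curve germ has at
  most ONE strict-transform germ at the next member — lineages do not branch);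
* `finite_setOf_isPrime_height_one_mem` — in a Noetherian domain only finitely many height-one primes contain a given
  non-zero element (they are minimal over it) — finiteness of the singular curves once one derivation value is non-zero;
* `exists_forall_ge_eq_of_antitone_of_finite` — an antitone sequence of sets starting at a finite set is eventually
  constant (the bad sets, transported to a fixed index set, stabilise).

No Theses file of W4.1 is imported; nothing here is a route item. OURS (the W4.1 engine), standard commutative algebra;
NOT a statement of the manuscript under review [claim: Hironaka2017, status: under-review]. [cite: Cutkosky2014, §2.1]
[cite: Matsumura1987, Thm. 13.5] [folklore]
-/

noncomputable section

-- `Summit.<S>.<S>.…` duplicates the summit name by design (single-problem summit).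
set_option linter.dupNamespace false

open IsLocalRing Literature.AlgebraicGeometry.Resolution

namespace Summit.ResolutionOfSingularities.ResolutionOfSingularities.Theorems.SwitchingDichotomy.BadCurveLineage

variable {K : Type} [Field K]

/-! ## §1 Primes of the transform off the exceptional prime are determined by their contraction -/

/-- Off the exceptional prime every element of the quadratic transform `A'` is a fraction `a / b` with `a, b ∈ A` and
`b ∉ 𝔮'` (in particular `b ∉ 𝔮' ∩ A`): `A' ⊆ A_{𝔮' ∩ A}` inside the field. [cite: Cutkosky2014, §2.1] -/
theorem exists_div_of_quadraticTransform {A A' : Subring K} [IsLocalRing A] (h : IsQuadraticTransform A A')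
    (𝔮' : Ideal A') [𝔮'.IsPrime] (hne : 𝔮'.comap (Subring.inclusion h.dominates.1) ≠ maximalIdeal A)
    {z : K} (hz : z ∈ A') :
    ∃ (a b : K) (_ : a ∈ A) (hb : b ∈ A), (⟨b, h.dominates.1 hb⟩ : A') ∉ 𝔮' ∧ b ≠ 0 ∧ z = a / b := by
  have h1 : (⟨(1 : K), A'.one_mem⟩ : A') ∉ 𝔮' := by
    have : (⟨(1 : K), A'.one_mem⟩ : A') = 1 := Subtype.ext rfl
    rw [this]
    exact (Ideal.ne_top_iff_one _).mp (Ideal.IsPrime.ne_top inferInstance)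
  obtain ⟨a, b, ha, hb, hbq, hzb⟩ := BadCurveStep.exists_mul_eq_mul_of_quadraticTransform h 𝔮' hne hz A'.one_mem h1
  have hb0 : b ≠ 0 := by
    intro h0
    apply hbq
    have : (⟨b, h.dominates.1 hb⟩ : A') = 0 := Subtype.ext h0
    rw [this]; exact Ideal.zero_mem _
  refine ⟨a, b, ha, hb, hbq, hb0, ?_⟩
  rw [mul_one] at hzb
  rw [← hzb, mul_div_cancel_right₀ _ hb0]

/-- **Membership in a non-exceptional prime is read on the contraction**: `z ∈ 𝔮'` iff `z · b = a` for some `a ∈ 𝔮' ∩ A`,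
`b ∈ A ∖ 𝔮'`. [folklore] -/
theorem mem_iff_of_quadraticTransform {A A' : Subring K} [IsLocalRing A] (h : IsQuadraticTransform A A')
    (𝔮' : Ideal A') [𝔮'.IsPrime] (hne : 𝔮'.comap (Subring.inclusion h.dominates.1) ≠ maximalIdeal A)
    {z : K} (hz : z ∈ A') :
    (⟨z, hz⟩ : A') ∈ 𝔮' ↔ ∃ (a b : K) (ha : a ∈ A) (hb : b ∈ A), (⟨b, h.dominates.1 hb⟩ : A') ∉ 𝔮' ∧
      (⟨a, ha⟩ : A) ∈ 𝔮'.comap (Subring.inclusion h.dominates.1) ∧ z * b = a := by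
  have hle := h.dominates.1
  constructor
  · intro hzq
    obtain ⟨a, b, ha, hb, hbq, hb0, hzab⟩ := exists_div_of_quadraticTransform h 𝔮' hne hz
    have hzb : z * b = a := by rw [hzab, div_mul_cancel₀ _ hb0]
    refine ⟨a, b, ha, hb, hbq, ?_, hzb⟩
    rw [Ideal.mem_comap]
    have : Subring.inclusion hle ⟨a, ha⟩ = ⟨z, hz⟩ * ⟨b, hle hb⟩ := Subtype.ext hzb.symm
    rw [this]
    exact Ideal.mul_mem_right _ _ hzq
  · rintro ⟨a, b, ha, hb, hbq, haq, hzb⟩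
    rw [Ideal.mem_comap] at haq
    have hprod : (⟨z, hz⟩ : A') * ⟨b, hle hb⟩ ∈ 𝔮' := by
      have : (⟨z, hz⟩ : A') * ⟨b, hle hb⟩ = Subring.inclusion hle ⟨a, ha⟩ := Subtype.ext hzb
      rw [this]; exact haq
    rcases Ideal.IsPrime.mem_or_mem inferInstance hprod with h1 | h1
    · exact h1
    · exact absurd h1 hbq

/-- **Lineages do not branch**: two primes of the quadratic transform `A'` with the same contraction to `A`, not the
maximal ideal, are EQUAL (a curve germ on the base has at most one strict-transform germ at the next member of the tower).
[folklore] -/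
theorem eq_of_comap_eq_of_quadraticTransform {A A' : Subring K} [IsLocalRing A] (h : IsQuadraticTransform A A')
    (𝔮₁ 𝔮₂ : Ideal A') [𝔮₁.IsPrime] [𝔮₂.IsPrime]
    (hne : 𝔮₁.comap (Subring.inclusion h.dominates.1) ≠ maximalIdeal A)
    (heq : 𝔮₁.comap (Subring.inclusion h.dominates.1) = 𝔮₂.comap (Subring.inclusion h.dominates.1)) : 𝔮₁ = 𝔮₂ := by
  have hne₂ : 𝔮₂.comap (Subring.inclusion h.dominates.1) ≠ maximalIdeal A := heq ▸ hne
  ext ⟨z, hz⟩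
  rw [mem_iff_of_quadraticTransform h 𝔮₁ hne hz, mem_iff_of_quadraticTransform h 𝔮₂ hne₂ hz]
  constructor
  · rintro ⟨a, b, ha, hb, hbq, haq, hzb⟩
    refine ⟨a, b, ha, hb, fun hb₂ => hbq ?_, heq ▸ haq, hzb⟩
    have : (⟨b, hb⟩ : A) ∈ 𝔮₂.comap (Subring.inclusion h.dominates.1) := hb₂
    rw [← heq] at this
    exact this
  · rintro ⟨a, b, ha, hb, hbq, haq, hzb⟩
    refine ⟨a, b, ha, hb, fun hb₁ => hbq ?_, heq.symm ▸ haq, hzb⟩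
    have : (⟨b, hb⟩ : A) ∈ 𝔮₁.comap (Subring.inclusion h.dominates.1) := hb₁
    rw [heq] at this
    exact this

/-! ## §2 Finiteness of the singular curves through a non-zero derivation value -/

/-- **In a Noetherian domain only finitely many height-one primes contain a given non-zero element** (each is a
minimal prime over it, and minimal primes over an ideal are finite in number). [cite: Matsumura1987, Thm. 13.5] -/
theorem finite_setOf_isPrime_height_one_mem {A : Type*} [CommRing A] [IsDomain A] [IsNoetherianRing A] {a : A}
    (ha : a ≠ 0) : {𝔮 : Ideal A | 𝔮.IsPrime ∧ 𝔮.height = 1 ∧ a ∈ 𝔮}.Finite := by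
  refine (Ideal.finite_minimalPrimes_of_isNoetherianRing _ (Ideal.span {a})).subset ?_
  rintro 𝔮 ⟨h𝔮, hht, hmem⟩
  haveI := h𝔮
  haveI : 𝔮.FiniteHeight := ⟨Or.inr (by rw [hht]; exact ENat.one_ne_top)⟩
  refine Ideal.mem_minimalPrimes_of_height_eq ((Ideal.span_singleton_le_iff_mem _).mpr hmem) ?_
  rw [hht]
  exact Ideal.one_le_height_span_singleton_of_mem_nonZeroDivisors (mem_nonZeroDivisors_of_ne_zero ha)

/-! ## §3 Stabilisation of the bad sets -/

/-- **An antitone sequence of sets below a finite set is eventually constant.** [folklore] -/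
theorem exists_forall_ge_eq_of_antitone_of_finite {α : Type*} (S : ℕ → Set α) (hS : ∀ n, S (n + 1) ⊆ S n)
    (hfin : (S 0).Finite) : ∃ N, ∀ n, N ≤ n → S n = S N := by
  classical
  have hanti : Antitone S := antitone_nat_of_succ_le hS
  have hfin' : ∀ n, (S n).Finite := fun n => hfin.subset (hanti (Nat.zero_le n))
  -- the cardinalities form an antitone sequence of naturals
  set c : ℕ → ℕ := fun n => (hfin' n).toFinset.card with hc
  have hcanti : ∀ n, c (n + 1) ≤ c n := fun n =>
    Finset.card_le_card (by
      intro a ha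
      rw [Set.Finite.mem_toFinset] at ha ⊢
      exact hS n ha)
  have hcA : Antitone c := antitone_nat_of_succ_le hcanti
  -- an antitone ℕ-sequence stabilises
  obtain ⟨N, hN⟩ : ∃ N, ∀ n, N ≤ n → c n = c N := by
    by_contra hcon
    push Not at hcon
    have key : ∀ k : ℕ, ∃ n, c n + k ≤ c 0 := by
      intro k
      induction k with
      | zero => exact ⟨0, by simp⟩
      | succ k ih =>
        obtain ⟨n, hn⟩ := ih
        obtain ⟨m, hnm, hm⟩ := hcon n
        have h1 : c m < c n := lt_of_le_of_ne (hcA hnm) hm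
        exact ⟨m, by omega⟩
    obtain ⟨n, hn⟩ := key (c 0 + 1)
    omega
  refine ⟨N, fun n hn => ?_⟩
  have hsub : S n ⊆ S N := hanti hn
  have hcard : (hfin' n).toFinset.card = (hfin' N).toFinset.card := hN n hn
  have heq : (hfin' n).toFinset = (hfin' N).toFinset :=
    Finset.eq_of_subset_of_card_le (by
      intro a ha
      rw [Set.Finite.mem_toFinset] at ha ⊢
      exact hsub ha) hcard.ge
  ext a
  have := congrArg (fun s : Finset α => a ∈ s) heq
  simpa [Set.Finite.mem_toFinset] using this

end Summit.ResolutionOfSingularities.ResolutionOfSingularities.Theorems.SwitchingDichotomy.BadCurveLineage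

end
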